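import Summits.HodgeConjecture.HodgeConjecture.Theses.EndoscopicMiddleDegree
import Literature.AlgebraicTopology.SingularHomology.FiniteDeckTransfer
import Literature.AlgebraicTopology.SingularHomology.CohomologyRingChange
import Literature.AlgebraicGeometry.HodgeTheory.VanishingCohomologyNontrivialProofs

/-!
# Stub `stub_heckeIdempotents` (line `conjugate-dimension-sieve` of crux
# `EndoscopicMiddleDegree.MiddleThetaSpan`, stmt-HodgeConjecture-13661): Hecke block idempotents

Registered skeleton `Cruxes/MiddleThetaSpan/Lines/conjugate-dimension-sieve.lean`; this is the file
`Theorems/EndoscopicMiddleDegreeMiddleThetaSpanHeckeIdempotents.lean` of the summit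
(`--supports stmt-HodgeConjecture-13661`). It is ALSO THE HOME OF THE LINE'S VOCABULARY (section
"Vocabulary", verbatim from the registered skeleton: `HeckeDatum`, `HeckeDatum.op`, `heckeOperators`,
`heckeAlgebra`, `IsCentralIdempotent`, `IsPrimitiveCentralIdempotent`, `conjAct`, `IsConjugate`,
`primitivePart`, `IsHeckeLefschetzClass`, `typedSpan`, `middleThetaSpan_iff`,
`IsTateType`/`IsKilledType`/`IsCoreType`): the gate requires every `--supports` file on a crux with
registered stubs to prove one of them (`supports.stub-mismatch` bounced a stand-alone
`EndoscopicMiddleDegreeDefs.lean`, p78673), so the vocabulary rides with the first stub that closed; the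
other stub files (`…MiddleThetaSpanSieve.lean`, …) import THIS module for it.

WHAT IS PROVED. `stub_heckeIdempotents`: for `m ∈ {1, 2}` and a ball-quotient datum `D` on `X`,
the Hecke algebra `𝓗 = heckeAlgebra D (2(m+1)) ⊆ End_ℂ H`, `H = H^{2(m+1)}(X(ℂ); ℂ)`, has a finite
family `s` of primitive central idempotents (`IsPrimitiveCentralIdempotent`), `Σ_{e ∈ s} e = 1`.
Nothing about Hecke operators is used: `exists_primitiveCentralIdempotents` proves it for EVERY
subalgebra `A ⊆ End_ℂ H` of a finite-dimensional `ℂ`-space `H`, and `H` is finite-dimensional by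
the tree's `finite_complexBetti` (proved) at `D.isSmoothProjective`. Otherwise Mathlib only.

HOW. (1) `exists_finset_primitive_idempotents`: a commutative Artinian ring has a finite set of non-zero
idempotents summing to `1`, each primitive — lift the standard idempotents of the finite product of fields
`R ⧸ nil(R) ≃ Π_𝔪 R ⧸ 𝔪` (`IsArtinianRing.quotNilradicalEquivPi`) along the nil ideal
(`CompleteOrthogonalIdempotents.lift_of_isNilpotent_ker`; uniqueness of idempotent lifts
`eq_of_isNilpotent_sub_of_isIdempotentElem` gives `f e ∈ {0, e}`). (2) `exists_primitiveCentralIdempotents`: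
the centre `Subalgebra.center ℂ A` is commutative and finite-dimensional, hence Artinian
(`IsArtinianRing.of_finite`); a central idempotent of `A` IS an idempotent of the centre. (3) Specialise to
`A = heckeAlgebra D (2(m+1))`. Sources: Matsushima / Hecke decomposition (Borel–Wallach Ch. VII; BMM
arXiv:1306.1515 Part 2 §1.8) for the meaning; Atiyah–Macdonald Thm. 8.7 / Stacks 00J9 for what is proved.
-/

noncomputable section

namespace Summit.HodgeConjecture.HodgeConjecture.Cruxes.MiddleThetaSpan.ConjugateDimensionSieve

open scoped BigOperators
open Literature.AlgebraicGeometry.Motives (SchemeOver ComplexPoints)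
open Literature.AlgebraicGeometry.HodgeTheory
open Literature.AlgebraicGeometry.ShimuraVarieties
open Literature.AlgebraicTopology.SingularHomology
open Summit.HodgeConjecture.HodgeConjecture.Theses.EndoscopicMiddleDegree

-- The crux-workfile namespace `Summit.<P>.<Sub>.Cruxes.…` repeats `HodgeConjecture` (single-conjunct summit).
set_option linter.dupNamespace false

/-! ## Vocabulary of line `conjugate-dimension-sieve` (verbatim from the registered skeleton; home copy) -/

variable {p : ℕ} {X : SchemeOver ℂ}

/-! ## Vocabulary: classical Hecke operators of `Γ\𝔹`, pinned by the uniformization -/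

/-- **Hecke datum** for `g ∈ U(V)(F)` on the ball quotient `X(ℂ) ≅ Γ\𝔹` of `D`: a presentation of the
Hecke correspondence `Γv ↦ Σ_{γ ∈ N\Γ} Γgγv` on a FINITE REGULAR COVER. Data: a subgroup `N ≤ Γ` with
`gNg⁻¹ ≤ Γ` (so `N ≤ Γ ∩ g⁻¹Γg`); a finite regular covering `cov : E → X(ℂ)` (the tree's
`FiniteDeckCover`, deck group `G`); a second continuous map `q : E → X(ℂ)`; and a map `u : ℂ^{p+1} → E`
which on the negative cone is continuous, onto `E`, has fibres exactly the `N·ℂˣ`-orbits, and satisfies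
`cov ∘ u = unif`, `q ∘ u = unif ∘ g`. These conditions force `E ≅ N\𝔹` over `X(ℂ)` (a continuous
bijection of coverings of the manifold `X(ℂ)` commuting with the projections is a homeomorphism),
`cov = (Nv ↦ Γv)`, `q = (Nv ↦ Γgv)`; the intended instances (`N` = a normal finite-index subgroup of
`Γ ∩ g⁻¹Γg`, `E = N\𝔹`, `G = Γ/N`) exist for every `g ∈ U(V)(F)` (congruence `Γ`; torsion-freeness
makes `Γ/N` act freely), but are not constructed here. [BMM arXiv:1306.1515 Part 2 §1.8 (`ℋ_K`);
Shimura, Introduction to the arithmetic theory of automorphic functions (1971), Ch. 3 (the Hecke ring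
of `(Γ, G(ℚ))`) and Ch. 7 (Hecke operators as algebraic correspondences, acting by `p₁_* ∘ p₂^*`).]
[cite: BergeronMillsonMoeglin2016Balls, Part 2 §1.8] -/
structure HeckeDatum (D : UnitaryBallQuotientDatum p X) (g : GL (Fin (p + 1)) D.E) where
  /-- The level of the auxiliary cover, `N ≤ Γ ∩ g⁻¹Γg`. -/
  N : Subgroup (GL (Fin (p + 1)) D.E)
  /-- The deck group of the auxiliary cover (`≅ Γ/N`). -/
  G : Type
  /-- group structure of the deck group -/
  [instGroup : Group G]
  /-- the deck group is finite -/
  [instFintype : Fintype G]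
  /-- The total space of the auxiliary cover (`≅ N\𝔹`). -/
  E : Type
  /-- topology of the cover -/
  [instTopologicalSpace : TopologicalSpace E]
  /-- deck action -/
  [instMulAction : MulAction G E]
  /-- The finite regular covering `E → X(ℂ)`, `Nv ↦ Γv`. -/
  cov : FiniteDeckCover G E (ComplexPoints X)
  /-- The twisted projection `E → X(ℂ)`, `Nv ↦ Γgv`. -/
  q : C(E, ComplexPoints X)
  /-- The uniformization of `E` by the negative cone (junk off the cone). -/
  u : (Fin (p + 1) → ℂ) → E
  /-- `g` is an isometry of `V`. -/
  g_mem : g ∈ unitaryGroup (conjRingHom D.E) D.H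
  /-- `N ≤ Γ`. -/
  N_le : N ≤ D.Γ
  /-- `g N g⁻¹ ≤ Γ`. -/
  conj_mem : ∀ γ ∈ N, g * γ * g⁻¹ ∈ D.Γ
  /-- `u` maps the negative cone onto `E`. -/
  surjOn_u : Set.SurjOn u D.cone Set.univ
  /-- `u` is continuous on the cone. -/
  continuousOn_u : ContinuousOn u D.cone
  /-- `cov ∘ u = unif` on the cone. -/
  proj_u : ∀ v ∈ D.cone, cov.proj (u v) = D.unif v
  /-- `q ∘ u = unif ∘ g` on the cone. -/
  q_u : ∀ v ∈ D.cone, q (u v) = D.unif (D.act g v)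
  /-- The fibres of `u` on the cone are the `N·ℂˣ`-orbits. -/
  u_eq_u_iff : ∀ v ∈ D.cone, ∀ w ∈ D.cone,
    u v = u w ↔ ∃ γ ∈ N, ∃ c : ℂ, c ≠ 0 ∧ D.act γ v = c • w

attribute [instance] HeckeDatum.instGroup HeckeDatum.instFintype HeckeDatum.instTopologicalSpace
  HeckeDatum.instMulAction

namespace HeckeDatum

variable {D : UnitaryBallQuotientDatum p X} {g : GL (Fin (p + 1)) D.E}

/-- The (un-normalised) **Hecke operator** of the datum on `Hᵏ(X(ℂ); ℂ)`: pull back along `q` to the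
cover, then transfer (= `[Γ ∩ g⁻¹Γg : N] · T_{ΓgΓ}`; positive integer multiples do not change the
ℂ-algebra generated). [cite: BergeronMillsonMoeglin2016Balls, Part 2 §1.8] -/
def op (Δ : HeckeDatum D g) (k : ℕ) : Module.End ℂ (complexBetti X k) :=
  (Δ.cov.transferMap (R := ℂ) k).hom ∘ₗ (singularCohomology.map ℂ ℂ Δ.q k).hom

end HeckeDatum

/-- The set of classical Hecke operators on `Hᵏ(X(ℂ); ℂ)` (all `g ∈ U(V)(F)`, all presentations).
[cite: BergeronMillsonMoeglin2016Balls, Part 2 §1.8] -/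
def heckeOperators (D : UnitaryBallQuotientDatum p X) (k : ℕ) :
    Set (Module.End ℂ (complexBetti X k)) :=
  {T | ∃ (g : GL (Fin (p + 1)) D.E) (Δ : HeckeDatum D g), T = Δ.op k}

/-- The **Hecke algebra** `𝓗 ⊆ End_ℂ Hᵏ(X(ℂ); ℂ)`: the ℂ-subalgebra generated by the classical Hecke
operators (the image of the classical Hecke ring of `(Γ, U(V)(F))` tensored with `ℂ`).
[cite: BergeronMillsonMoeglin2016Balls, Part 2 §1.8] -/
def heckeAlgebra (D : UnitaryBallQuotientDatum p X) (k : ℕ) :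
    Subalgebra ℂ (Module.End ℂ (complexBetti X k)) :=
  Algebra.adjoin ℂ (heckeOperators D k)

/-- `e` is a **central idempotent** of the subalgebra `A ⊆ End M`. [folklore] -/
def IsCentralIdempotent {M : Type*} [AddCommGroup M] [Module ℂ M]
    (A : Subalgebra ℂ (Module.End ℂ M)) (e : Module.End ℂ M) : Prop :=
  e ∈ A ∧ e * e = e ∧ ∀ a ∈ A, a * e = e * a

/-- `e` is a **primitive central idempotent** of `A`: non-zero, central idempotent, and not the sum of
two orthogonal non-zero central idempotents (for `A` semisimple acting faithfully on `M`, the `e(M)` are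
exactly the isotypic components of `M`). [folklore] -/
def IsPrimitiveCentralIdempotent {M : Type*} [AddCommGroup M] [Module ℂ M]
    (A : Subalgebra ℂ (Module.End ℂ M)) (e : Module.End ℂ M) : Prop :=
  IsCentralIdempotent A e ∧ e ≠ 0 ∧ ∀ f, IsCentralIdempotent A f → f * e = 0 ∨ f * e = e

/-- The **coefficient action** of `σ ∈ Aut(ℂ)` on `Hᵏ(X(ℂ); ℂ) = Hᵏ(X(ℂ); ℚ) ⊗ ℂ`: the tree's change of
coefficient ring along `σ` (additive, `σ`-semilinear, fixes rational classes, commutes with cup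
products and with pull-backs/transfers). It conjugates COEFFICIENTS, never the variety.
[cite: HatcherAT2002, §3.1] -/
def conjAct (X : SchemeOver ℂ) (σ : ℂ ≃+* ℂ) (k : ℕ) : complexBetti X k →+ complexBetti X k :=
  singularCohomology.ringChange (σ : ℂ →+* ℂ) (ComplexPoints X) k

/-- `e'` is the **`σ`-conjugate** of the endomorphism `e`: `σ_* ∘ e = e' ∘ σ_*` (for the isotypic
projector `e ↔ π_f` this is `e' ↔ σπ_f`, BMM Part 2 §1.9). [cite: BergeronMillsonMoeglin2016Balls, Part 2 §1.9] -/
def IsConjugate (X : SchemeOver ℂ) (k : ℕ) (σ : ℂ ≃+* ℂ) (e e' : Module.End ℂ (complexBetti X k)) :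
    Prop :=
  ∀ x, conjAct X σ k (e x) = e' (conjAct X σ k x)

/-- The **primitive part** `P = ker(· ∪ ℓ : H²ⁿ → H²ⁿ⁺²)` of the middle cohomology `H²ⁿ(X(ℂ); ℂ)`,
`n = m + 1`, for a degree-2 class `ℓ` (Lefschetz: `H²ⁿ = P ⊕ ℓ ∪ H²ⁿ⁻²` when `ℓ` is a Kähler class).
[cite: VoisinHodgeI2002, §6.2.3] -/
def primitivePart (ℓ : complexBetti X (2 * 1)) (m : ℕ) : Submodule ℂ (complexBetti X (2 * (m + 1))) :=
  LinearMap.ker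
    ((cupProduct (Literature.AlgebraicGeometry.HodgeTheory.two_mul_add_two_mul (m + 1) 1)).flip ℓ)

/-- `ℓ ∈ H²(X(ℂ); ℂ)` is a **Hecke-invariant Lefschetz class** for the middle degree `2(m+1)`:
algebraic (a divisor class), rational, HARD LEFSCHETZ across the middle (`· ∪ ℓ ∪ ℓ : H^{2m} → H^{2m+4}`
is bijective — this excludes the degenerate `ℓ = 0`, under which the primitive part would be all of
`H²ⁿ` and `stub_coreVanishing` false, and is exactly what the Lefschetz split uses), and pulled back
identically by the two projections of every Hecke datum
(`q^* ℓ = cov^* ℓ` on the cover) — as `c₁(K_X)` is (`K_X` is ample on a compact ball quotient and pulls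
back to `K` along both local biholomorphisms). By the projection formula every Hecke operator then
commutes with `· ∪ ℓ`; automorphically the Hecke-invariant part of `H²` is the line `ℂ · c₁(K_X)`
(`H²(𝔤,K;𝟙)` is one-dimensional), so these are the classes `r · c₁(K_X)`, `r ∈ ℚˣ`.
[cite: VoisinHodgeI2002, Thm. 6.25] -/
def IsHeckeLefschetzClass (D : UnitaryBallQuotientDatum p X) (m : ℕ) (ℓ : complexBetti X (2 * 1)) :
    Prop :=
  ℓ ∈ algebraicClasses X 1 ∧ IsRationalClass ℓ ∧
    Function.Bijective
      ((cupProduct (Literature.AlgebraicGeometry.HodgeTheory.two_mul_add_two_mul (m + 1) 1)).flip ℓ ∘ₗ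
        (cupProduct (Literature.AlgebraicGeometry.HodgeTheory.two_mul_add_two_mul m 1)).flip ℓ :
          complexBetti X (2 * m) →ₗ[ℂ] complexBetti X (2 * (m + 1 + 1))) ∧
    ∀ (g : GL (Fin (p + 1)) D.E) (Δ : HeckeDatum D g),
      singularCohomology.map ℂ ℂ Δ.q (2 * 1) ℓ = singularCohomology.map ℂ ℂ Δ.cov.proj (2 * 1) ℓ

/-- The **typed span** of the crux at `(m, X, D)` — VERBATIM the right-hand side of `MiddleThetaSpan`:
`SC^{m+1}(D) ⊔ span{s ∪ d : s ∈ SC^m(D), d ∈ N¹} ⊔ span{a ∪ d : a rational Hodge (m,m), d ∈ N¹}`.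
[cite: BergeronMillsonMoeglin2016Balls, Introduction Thm 4 and Remark 3] -/
def typedSpan (m : ℕ) (X : SchemeOver ℂ) (D : UnitaryBallQuotientDatum (2 * (m + 1)) X) :
    Submodule ℂ (complexBetti X (2 * (m + 1))) :=
  (⨆ (W : Submodule D.E (Fin (2 * (m + 1) + 1) → D.E))
      (_ : IsTotallyPositive (conjRingHom D.E) D.H W) (_ : Module.finrank D.E W = m + 1),
      classesSupportedOn X (D.specialSubvariety W) (2 * (m + 1))) ⊔
  Submodule.span ℂ {z : complexBetti X (2 * (m + 1)) |
    ∃ s ∈ (⨆ (W : Submodule D.E (Fin (2 * (m + 1) + 1) → D.E))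
      (_ : IsTotallyPositive (conjRingHom D.E) D.H W) (_ : Module.finrank D.E W = m),
      classesSupportedOn X (D.specialSubvariety W) (2 * m)),
      ∃ d ∈ algebraicClasses X 1,
        z = cupProduct (Literature.AlgebraicGeometry.HodgeTheory.two_mul_add_two_mul m 1) s d} ⊔
  Submodule.span ℂ {z : complexBetti X (2 * (m + 1)) |
    ∃ a : complexBetti X (2 * m), IsRationalClass a ∧
      IsOfHodgeType (2 * (m + 1)) X (2 * m) m m a ∧
      ∃ d ∈ algebraicClasses X 1,
        z = cupProduct (Literature.AlgebraicGeometry.HodgeTheory.two_mul_add_two_mul m 1) a d}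

/-- The crux unfolds DEFINITIONALLY to "every rational `(m+1,m+1)`-class lies in `typedSpan m X D`".
[cite: BergeronMillsonMoeglin2016Balls, Introduction Thm 4] -/
theorem middleThetaSpan_iff :
    MiddleThetaSpan ↔
      ∀ (m : ℕ) (X : SchemeOver ℂ) (D : UnitaryBallQuotientDatum (2 * (m + 1)) X), 1 ≤ m → m ≤ 2 →
        ∀ c : complexBetti X (2 * (m + 1)), IsRationalClass c →
          IsOfHodgeType (2 * (m + 1)) X (2 * (m + 1)) (m + 1) (m + 1) c → c ∈ typedSpan m X D :=
  Iff.rfl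

/-! ## The trichotomy of Hecke pieces (pure logic; automorphic meaning in the docstrings) -/

section Trichotomy

variable (D : UnitaryBallQuotientDatum p X) (ℓ : complexBetti X (2 * 1)) (m : ℕ)

/-- **(T) Tate type.** The primitive piece `e(P)` of `e` AND of every conjugate `e^σ` is purely of Hodge
type `(m+1, m+1)`. Automorphically (Matsushima + Vogan–Zuckerman): `Σ(σπ_f) = {A(n,n)}` for every
`σ ∈ Aut(ℂ)` — the sign-selected SINGLETON pieces whose middle character `χ₀` is parallel
(finite order · ‖·‖), i.e. the Tate-type pieces of the card; by `stub_sieve` the rational structure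
`e(P) ⊕ conjugates` is then a Hodge–Tate ℚ-Hodge structure.
[cite: BergeronMillsonMoeglin2016Balls, Part 2 §1.9] -/
def IsTateType (e : Module.End ℂ (complexBetti X (2 * (m + 1)))) : Prop :=
  (∀ c ∈ (primitivePart ℓ m).map e, IsOfHodgeType p X (2 * (m + 1)) (m + 1) (m + 1) c) ∧
    ∀ (σ : ℂ ≃+* ℂ) (e' : Module.End ℂ (complexBetti X (2 * (m + 1)))),
      IsPrimitiveCentralIdempotent (heckeAlgebra D (2 * (m + 1))) e' → IsConjugate X (2 * (m + 1)) σ e e' →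
        ∀ c ∈ (primitivePart ℓ m).map e', IsOfHodgeType p X (2 * (m + 1)) (m + 1) (m + 1) c

/-- **(K) Killed.** The primitive piece of `e`, or of some conjugate `e^σ`, carries NO non-zero class of
type `(m+1, m+1)`. Automorphically: `A(n,n) ∉ Σ(σπ_f)` for some `σ` — e.g. a singleton at `π_f` whose
character `χ₀` is not parallel; the would-be Hodge-not-Tate pieces. The sieve kills every rational
`(n,n)`-component here (`MiddleThetaSpan_of`, case (K)). [cite: BergeronMillsonMoeglin2016Balls, Part 2 §1.9] -/
def IsKilledType (e : Module.End ℂ (complexBetti X (2 * (m + 1)))) : Prop :=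
  (∀ c ∈ (primitivePart ℓ m).map e, IsOfHodgeType p X (2 * (m + 1)) (m + 1) (m + 1) c → c = 0) ∨
    ∃ (σ : ℂ ≃+* ℂ) (e' : Module.End ℂ (complexBetti X (2 * (m + 1)))),
      IsPrimitiveCentralIdempotent (heckeAlgebra D (2 * (m + 1))) e' ∧ IsConjugate X (2 * (m + 1)) σ e e' ∧
        ∀ c ∈ (primitivePart ℓ m).map e', IsOfHodgeType p X (2 * (m + 1)) (m + 1) (m + 1) c → c = 0

/-- **(C) Core.** Neither Tate type nor killed: every conjugate piece carries a non-zero `(n,n)`-class and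
some conjugate piece (possibly `e(P)` itself) also carries another type. By `stub_sieve` (b) (equal
dimensions of conjugate pieces) and Arthur–Mok/KMSW multiplicity one, `|Σ(σπ_f)| = d` is constant in
`σ`, so these are exactly the `π_f` with `d ≥ 2`: an irreducible constituent of dimension `d ≥ 2` of the
parameter owns the middle `τ₁`-coordinate at every real place (triage r1-1 correction: EVEN `d` occurs —
Ψ₄ ∋ 0 in 4+1, Ψ₂ ∋ 0 in 2+2+1 / 2+1+1+1 / 3+2 — besides Ψ₅ stable, 3+2, 3+1+1 at `p = 4`).
[cite: BergeronMillsonMoeglin2016Balls, Part 2 §1.9] -/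
def IsCoreType (e : Module.End ℂ (complexBetti X (2 * (m + 1)))) : Prop :=
  ¬ IsTateType D ℓ m e ∧ ¬ IsKilledType D ℓ m e

end Trichotomy
/-! ## End of the vocabulary -/

/-! ## Helper lemmas (worker): primitive idempotents of commutative Artinian rings and of centres -/

/-- **Primitive idempotents of a commutative Artinian ring.** A commutative Artinian ring `R` has a
finite set `s` of non-zero idempotents with `Σ_{e ∈ s} e = 1`, each *primitive*: `f e ∈ {0, e}`
for every idempotent `f` of `R` (i.e. `e R` is local). They are the lifts along the nil ideal
`nil(R)` of the standard idempotents of the finite product of fields `R ⧸ nil(R) ≃ Π_{𝔪} R ⧸ 𝔪`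
(`IsArtinianRing.quotNilradicalEquivPi`, `CompleteOrthogonalIdempotents.lift_of_isNilpotent_ker`);
primitivity and non-vanishing are read off in the product of fields and pulled back by uniqueness
of idempotent lifts (`eq_of_isNilpotent_sub_of_isIdempotentElem`). For `R = 0`, `s = ∅`.
[folklore: Atiyah–Macdonald, Introduction to Commutative Algebra, Ch. 8 Thm. 8.7; Stacks 00J9] -/
theorem exists_finset_primitive_idempotents (R : Type*) [CommRing R] [IsArtinianRing R] :
    ∃ s : Finset R,
      (∀ e ∈ s, IsIdempotentElem e ∧ e ≠ 0 ∧
        ∀ f : R, IsIdempotentElem f → f * e = 0 ∨ f * e = e) ∧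
      ∑ e ∈ s, e = 1 := by
  classical
  letI : Fintype (MaximalSpectrum R) := Fintype.ofFinite _
  set π : R →+* R ⧸ nilradical R := Ideal.Quotient.mk (nilradical R) with hπdef
  have hπ : ∀ x ∈ RingHom.ker π, IsNilpotent x := fun x hx => by
    rwa [hπdef, Ideal.mk_ker, mem_nilradical] at hx
  have hπ' : ∀ x, π x = 0 → IsNilpotent x := fun x hx => hπ x ((RingHom.mem_ker).2 hx)
  let φ := IsArtinianRing.quotNilradicalEquivPi R
  -- the standard idempotents of the product of residue fields, pulled back to `R ⧸ nil(R)`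
  have hē : CompleteOrthogonalIdempotents
      (φ.symm.toRingEquiv.toRingHom ∘ fun I : MaximalSpectrum R =>
        (Pi.single I 1 : ∀ J : MaximalSpectrum R, R ⧸ J.asIdeal)) :=
    (CompleteOrthogonalIdempotents.single _).map _
  -- lift them along the nil ideal `nil(R)`
  obtain ⟨e, he, heē⟩ := CompleteOrthogonalIdempotents.lift_of_isNilpotent_ker π hπ hē
    (fun I => RingHom.mem_range.2 (Ideal.Quotient.mk_surjective _))
  have heI : ∀ I, φ (π (e I)) = Pi.single I 1 := fun I => by
    have := congrFun heē I
    simp only [Function.comp_apply] at this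
    simp [this]
  -- each `e I` is non-zero: its image `Pi.single I 1` is non-zero in the field `R ⧸ I`
  have hne : ∀ I, e I ≠ 0 := fun I h => by
    haveI : Nontrivial (R ⧸ I.asIdeal) := Ideal.Quotient.nontrivial_iff.mpr I.isMaximal.ne_top
    simpa [h] using congrFun (heI I) I
  -- primitivity: the image of `f * e I` is `Pi.single I c`, `c ∈ {0, 1}` an idempotent of a field
  have hprim : ∀ I (f : R), IsIdempotentElem f → f * e I = 0 ∨ f * e I = e I := by
    intro I f hf
    have hg : IsIdempotentElem (f * e I) := hf.mul (he.idem I)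
    have hF : IsIdempotentElem (φ (π f) I) := congrFun ((hf.map π).map φ).eq I
    have hFg : φ (π (f * e I)) = Pi.single I (φ (π f) I) := by
      rw [map_mul, map_mul, heI, ← Pi.single_mul_right, mul_one]
    rcases IsIdempotentElem.iff_eq_zero_or_one.mp hF with h0 | h1
    · left
      rw [h0, Pi.single_zero, EmbeddingLike.map_eq_zero_iff] at hFg
      exact eq_of_isNilpotent_sub_of_isIdempotentElem hg IsIdempotentElem.zero
        (by rw [sub_zero]; exact hπ' _ hFg)
    · right
      rw [h1, ← heI I, EmbeddingLike.apply_eq_iff_eq] at hFg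
      refine eq_of_isNilpotent_sub_of_isIdempotentElem hg (he.idem I) (hπ' _ ?_)
      rw [map_sub, hFg, sub_self]
  -- distinct maximal ideals give distinct (orthogonal, non-zero) idempotents
  have hinj : Function.Injective e := fun I J hIJ => by_contra fun hne' =>
    hne I (by simpa [← hIJ, (he.idem I).eq] using he.ortho hne')
  refine ⟨Finset.univ.image e, ?_, ?_⟩
  · intro x hx
    obtain ⟨I, -, rfl⟩ := Finset.mem_image.mp hx
    exact ⟨he.idem I, hne I, hprim I⟩
  · rw [Finset.sum_image (fun I _ J _ h => hinj h)]
    exact he.complete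

/-- **Block idempotents of a finite-dimensional algebra of operators.** For every subalgebra
`A ⊆ End_ℂ H` of the endomorphisms of a finite-dimensional `ℂ`-vector space `H` there is a finite
family `s` of primitive central idempotents of `A` with `Σ_{e ∈ s} e = 1` (`H = ⊕_{e ∈ s} e(H)` is
the block decomposition of `H` under `A`; for `A` semisimple the blocks are the isotypic
components). Proof: the centre `Z(A)` (`Subalgebra.center`) is a finite-dimensional commutative
`ℂ`-algebra, hence Artinian (`IsArtinianRing.of_finite`); its primitive idempotents
(`exists_finset_primitive_idempotents`), viewed in `End_ℂ H`, are central in `A`, and a central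
idempotent of `A` is an idempotent of `Z(A)`, so primitivity among central idempotents of `A` is
primitivity in `Z(A)`. For `H = 0`, `s = ∅`. [folklore: Curtis–Reiner, Methods of Representation
Theory I, §3D (block idempotents); Atiyah–Macdonald Ch. 8 Thm. 8.7] -/
theorem exists_primitiveCentralIdempotents {H : Type*} [AddCommGroup H] [Module ℂ H]
    [Module.Finite ℂ H] (A : Subalgebra ℂ (Module.End ℂ H)) :
    ∃ s : Finset (Module.End ℂ H),
      (∀ e ∈ s, IsPrimitiveCentralIdempotent A e) ∧ ∑ e ∈ s, e = 1 := by
  classical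
  let Z : Subalgebra ℂ A := Subalgebra.center ℂ A
  haveI : Module.Finite ℂ A := Module.Finite.of_injective A.val.toLinearMap Subtype.val_injective
  haveI : Module.Finite ℂ Z := Module.Finite.of_injective Z.val.toLinearMap Subtype.val_injective
  haveI : IsArtinianRing Z := IsArtinianRing.of_finite ℂ Z
  obtain ⟨s, hs, hsum⟩ := exists_finset_primitive_idempotents Z
  -- the injective algebra map `Z(A) → A → End H`
  let ι : Z →ₐ[ℂ] Module.End ℂ H := A.val.comp Z.val
  have hι : Function.Injective ι := fun x y h => Subtype.ext (Subtype.ext h)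
  refine ⟨s.map ⟨ι, hι⟩, ?_, ?_⟩
  · intro x hx
    obtain ⟨z, hz, rfl⟩ := Finset.mem_map.mp hx
    change IsPrimitiveCentralIdempotent A (ι z)
    obtain ⟨hzi, hz0, hzp⟩ := hs z hz
    -- `ι z ∈ A`; idempotent; central in `A`; non-zero; primitive among central idempotents of `A`
    -- (a central idempotent `f` of `A` is the idempotent `fz` of `Z(A)`)
    refine ⟨⟨(z : A).2, ?_, ?_⟩, ?_, ?_⟩
    · simpa only [map_mul] using congrArg ι hzi.eq
    · exact fun a ha => congrArg Subtype.val (Subalgebra.mem_center_iff.mp z.2 ⟨a, ha⟩)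
    · exact fun h => hz0 (hι (by rw [map_zero]; exact h))
    · rintro f ⟨hfA, hff, hfc⟩
      let fz : Z := ⟨⟨f, hfA⟩, Subalgebra.mem_center_iff.mpr fun b => Subtype.ext (hfc b b.2)⟩
      have hfzi : IsIdempotentElem fz := Subtype.ext (Subtype.ext hff)
      have hιf : ι fz = f := rfl
      rcases hzp fz hfzi with h0 | h1
      · exact Or.inl (by simpa only [map_mul, map_zero, hιf] using congrArg ι h0)
      · exact Or.inr (by simpa only [map_mul, hιf] using congrArg ι h1)
  · rw [Finset.sum_map]
    change ∑ z ∈ s, ι z = 1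
    rw [← map_sum, hsum, map_one]

/-! ## The registered stub (signature must stay BYTE-IDENTICAL) -/

/-- **Stub 2a — Hecke idempotents (KNOWN in print: Matsushima's formula, Borel–Wallach VII / BMM
(Mdec) §1.8 and Thm 61; finite-dimensional linear algebra in Lean).** For `m ∈ {1,2}` and a datum
`D`, the Hecke algebra `𝓗 = heckeAlgebra D (2n)` on `H = H²ⁿ(X(ℂ); ℂ)` has a finite family `s` of
primitive central idempotents with `Σ_{e ∈ s} e = 1` (the block decomposition `H = ⊕_e e(H)`; for the
genuine, semisimple `𝓗` these are the `ℚ`-Hecke-isotypic pieces `W([π_f])^Γ ⊗ ℂ`).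
Why true: `H` is finite-dimensional (`X(ℂ) ≃ₜ Γ\𝔹` is a compact manifold: datum fields
`isSmoothProjective`, `homeomorph`; tree `finite_singularHomology_of_compact_chartedSpace` + duality),
so the centre `Z(𝓗) ⊆ End_ℂ H` is a finite-dimensional commutative `ℂ`-algebra; its block idempotents
(projectors onto the simultaneous generalised eigenspaces of `Z(𝓗)`, polynomials in elements of
`Z(𝓗)`) are central, orthogonal, sum to `1`, and are primitive among CENTRAL idempotents (an idempotent
of the local ring `e Z(𝓗)` is `0` or `e`). Semisimplicity (Petersson normality of the `T_g`) is NOT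
needed and NOT claimed (lead's reshape 2026-08-16: the planner's `IsSemisimpleRing`/`P`-stability
conjuncts were unused by the composition and are dropped). Size M–L. Leans on:
`Algebra.adjoin`, `Subalgebra.center`, `Module.End.iSup_maxGenEigenspace_eq_top`,
`IsArtinianRing`, `CompleteOrthogonalIdempotents`, finite-dimensionality of `complexBetti`. -/
theorem stub_heckeIdempotents :
    ∀ (m : ℕ) (X : SchemeOver ℂ) (D : UnitaryBallQuotientDatum (2 * (m + 1)) X), 1 ≤ m → m ≤ 2 →
      ∃ s : Finset (Module.End ℂ (complexBetti X (2 * (m + 1)))),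
        (∀ e ∈ s, IsPrimitiveCentralIdempotent (heckeAlgebra D (2 * (m + 1))) e) ∧
        (∑ e ∈ s, e = 1) := by
  intro m X D _ _
  haveI := finite_complexBetti D.isSmoothProjective (2 * (m + 1))
  exact exists_primitiveCentralIdempotents (heckeAlgebra D (2 * (m + 1)))

end Summit.HodgeConjecture.HodgeConjecture.Cruxes.MiddleThetaSpan.ConjugateDimensionSieve

end
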